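import Summits.AtomisticToContinuum.FouriersLaw.Theses.HoelderEscapeProfile
import Summits.AtomisticToContinuum.FouriersLaw.Theorems.CornerNoDip.Negative.ColdHaloProfile

/-!
# `CornerNoDip` (crux stmt-AtomisticToContinuum-16009, route `HoelderEscapeProfile`):
# K2's conclusion does NOT follow from everything else the route owns — a COLD-HALO profile
# satisfies every frame-free clause of `FibreCalculus`, the conclusions of `LocalEnergyHalfHoelder`
# (K1), `AbelSpreadCeiling` and `AbelRegularity` (even with a finite POSITIVE Abel conductivity),
# evenness, and non-negativity of the fibred conductivity at every wavenumber, and still has a dip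
# of the fibred Abelian conductivity at `k = 0` on the parabolic scale (negative-side support,
# refuter cdisprove seat, cycle 1, 2026-08-17).

Companion of `Negative/FalseWithoutDynamics.lean` (`cornerNoDip_false_without_dynamics`: the
analytic shell with an ARBITRARY kernel is false, witness a frozen kernel `G x t = -[x = 1]`, i.e.
a Drude-type atom).  That witness is killed by any decay in Abel mean.  Here the witness obeys ALL
the structure the route extracts from the binding `G = ∫ j₀ (jₓ ∘ φ_t) dμ` through its crux
`FibreCalculus` (stmt-16011) — conservation, Bochner positivity in `x`, Parseval, the `k`-space
conservation law, Helfand–Abel — together with the conclusions of the three other analytic cruxes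
and `0 ≤ 𝒢_ν(k)` for all `k`; so a proof of `CornerNoDip` must use a property of the true heat /
current kernel that is invisible to all of them.  In the language of the registered lines: the
load-bearing stubs `heatprofile.stub_mesoNegativePartNegligible` (no negative Abel heating mass at
mesoscopic range) and `birth`'s long-range kernel sign cannot be bypassed by identities.

## The witness (everything finitely supported and exact; `ν = 1/n²` is the failing sequence)

* statics concentrated at the origin: `S0 = δ₀`, so `χ(k) ≡ 1`;
* `tri n x = #{(a,b) ∈ [0,n)² : x = a - b} / n²` — the Fejér triangle `(n - |x|)₊ / n²`, written as
  a pair count so that its cosine transform is MANIFESTLY a sum of two squares,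
  `Σ_x cos(kx) tri n x = ((Σ_{a<n} cos ka)² + (Σ_{a<n} sin ka)²)/n² ∈ [0, 1]`, with mass `1`,
  `tri n 0 = 1/n` and second moment `(n² - 1)/6` (`ColdHaloTriangle.lean`);
* the COLD-HALO PROFILE `prof n = (5/8)·tri n + (1/4)·tri n(· ∓ 2n) − (1/16)·tri n(· ∓ 4n)`:
  positive core, positive shoulders at `±2n`, NEGATIVE lobes at `±4n` ("sites at distance `4/√ν`
  from the heated site sit below equilibrium in Abel mean").  Its transform FACTORISES:
  `Σ_x cos(kx) prof n x = Fejér_n(k) · (5/8 + cos(2nk)/2 − cos(4nk)/8)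
                        = Fejér_n(k) · (1 − sin⁴(nk))  ∈ [0, 1]`
  (`ColdHaloProfile.lean`), so Bochner positivity AND `f̂_ν ≤ χ` (i.e. `𝒢_ν ≥ 0`) are automatic, the
  mass is `1` (conservation), the second moment is STILL `(n² - 1)/6` (the halo has zero second
  moment: `(1/4)·2·(2n)² = (1/16)·2·(4n)²`) but the FOURTH moment is negative — which is exactly
  what a dip at the corner means at leading order;
* `Sb ν = prof ⌈1/√ν⌉₊`, `Gh ν k = ν(χ(k) − f̂_ν(k))/(2 − 2cos k)` off `2πℤ` and the Helfand value
  `(ν/2)(Σx²Sb ν − Σx²S0)` on `2πℤ`.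

Then: K1 holds with `Ψ(ν) = Sb ν 0 = 5/(8⌈1/√ν⌉₊) ≤ (5/8)√ν`; the ceiling holds with
`Σx²Sb ν = (⌈1/√ν⌉₊² − 1)/6 ≤ 1/ν` (`ν ≤ 1`); the Abel conductivity `Gh ν 0 = ν(⌈1/√ν⌉₊² − 1)/12`
CONVERGES TO `κ₀ = 1/12 > 0` (`tendsto_ceil_model`); but at `ν = 1/n²`, `k* = π/(2n)`
(`|k*| ≤ 2√ν`) one has `sin⁴(nk*) = 1`, hence `f̂_ν(k*) = 0` and
`Gh ν k* = ν/(2 − 2cos k*) ≥ ν/k*² = 4/π² > 2/5 > 1/12 + 1/4 ≥ Gh ν 0 + 1/4`: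
a dip of size `> 0.3` on the window `a = 2` for every `ν₀`.  So `CornerNoDip`'s conclusion fails
with `a = 2`, `ε = 1/4`, while the route's desired output (`A(ν) → κ₀ > 0`) holds: K2 is a
sufficient, not a necessary, rung, and it is not implied by the rest of the route (consistency of
the shell WITH K2 is witnessed by the diffusive calibration `f̂_ν = χν/(ν + D(2 − 2cos k))`, not
formalised here).

Reading for provers.  The scaling function of this witness, `φ(u) = sinc²(u/2)(1 − sin⁴ u)`, is a
legitimate even-sector profile in every respect the route formalises; what excludes it physically
is MONOTONE (heat-kernel-like) relaxation of the energy mode on the diffusive scale — positivity of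
the Abel heating profile `S̄_ν(x) ≥ 0` at range `≳ 1/√ν` (line `heatprofile`), or a sign of the
long-range Abel current kernel (line `birth`).  Numerically (STRATEGY-CENSUS, job j024522, N = 1024,
T ∈ {0.3, 1, 3}) the true profile of the quartic pinned chain shows no cold halo; nothing in tree
proves it.  No new definitions: the witness is threaded through the helper lemmas as hypotheses
`htri`, `hprof` pinning abstract functions to the explicit formulas, and instantiated by `rfl` in the
final theorem.
-/

noncomputable section

namespace Summit.AtomisticToContinuum.FouriersLaw.Theorems.CornerNoDip.Negative.ColdHalo

open Finset Real MeasureTheory Set Filter Topology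

/-- **`CornerNoDip`'s conclusion does not follow from the rest of the route's analytic structure.**  The negated
proposition quantifies over the frame-free objects of `FibreCalculus` — statics `S0 = S(·,0)`, Abel
heating profile `Sb`, fibred Abelian conductivity `Gh`, with `fh`, `χk` BOUND to the cosine series
exactly as in `FibreCalculus` — and assumes, verbatim in shape: clauses (4)–(9), (11), (12) of
`FibreCalculus` (summabilities, `χ > 0`, conservation, Bochner, Parseval, the `k`-space
conservation law, Helfand–Abel with `A(ν) = Gh ν 0`), evenness of `Sb ν` and `S0`, `Ψ ≥ 0` and
the conclusion of `LocalEnergyHalfHoelder` (`Ψ(ν) = Sb ν 0 ≤ C√ν`), the conclusion of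
`AbelSpreadCeiling`, `AbelRegularity` in the strong form `A(ν) → κ₀ > 0`, and `0 ≤ Gh ν k` for
all `k`; and concludes `CornerNoDip`'s `∀ a ε ∃ ν₀ ∀ ν k` clause.  It is FALSE: witness the
cold-halo profile of the module docstring, `a = 2`, `ε = 1/4`, `ν = 1/m²`, `k = π/(2m)`. [folklore] -/
theorem cornerNoDip_not_from_route_shell :
    ¬ (∀ (S0 : ℤ → ℝ) (Sb : ℝ → ℤ → ℝ) (Gh fh : ℝ → ℝ → ℝ) (χk : ℝ → ℝ),
        fh = (fun (ν k : ℝ) => ∑' x : ℤ, Real.cos (k * (x : ℝ)) * Sb ν x) →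
        χk = (fun k : ℝ => ∑' x : ℤ, Real.cos (k * (x : ℝ)) * S0 x) →
        (∀ ν : ℝ, 0 < ν → Summable (fun x : ℤ => (1 + (x : ℝ) ^ 2) * |Sb ν x|)) →
        Summable (fun x : ℤ => (1 + (x : ℝ) ^ 2) * |S0 x|) →
        0 < χk 0 →
        (∀ ν : ℝ, 0 < ν → ∑' x : ℤ, Sb ν x = χk 0) →
        (∀ ν : ℝ, 0 < ν → ∀ k : ℝ, 0 ≤ fh ν k) →
        (∀ ν : ℝ, 0 < ν → ∫ k in (-Real.pi)..Real.pi, fh ν k = 2 * Real.pi * Sb ν 0) →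
        (∀ ν : ℝ, 0 < ν → ∀ k : ℝ, χk k - fh ν k = (2 - 2 * Real.cos k) * Gh ν k / ν) →
        (∀ ν : ℝ, 0 < ν →
          Gh ν 0 = ν / 2 * ((∑' x : ℤ, (x : ℝ) ^ 2 * Sb ν x) - ∑' x : ℤ, (x : ℝ) ^ 2 * S0 x)) →
        (∀ ν : ℝ, 0 < ν → ∀ x : ℤ, Sb ν (-x) = Sb ν x) →
        (∀ x : ℤ, S0 (-x) = S0 x) →
        (∀ ν : ℝ, 0 < ν → 0 ≤ Sb ν 0) →
        (∃ C ν₀ : ℝ, 0 < ν₀ ∧ ∀ ν : ℝ, 0 < ν → ν ≤ ν₀ → Sb ν 0 ≤ C * Real.sqrt ν) →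
        (∃ B ν₁ : ℝ, 0 < ν₁ ∧ ∀ ν : ℝ, 0 < ν → ν ≤ ν₁ →
          ∑' x : ℤ, (x : ℝ) ^ 2 * Sb ν x ≤ B / ν) →
        (∃ κ₀ : ℝ, 0 < κ₀ ∧
          Filter.Tendsto (fun ν : ℝ => Gh ν 0) (nhdsWithin (0:ℝ) (Set.Ioi 0)) (nhds κ₀)) →
        (∀ ν : ℝ, 0 < ν → ∀ k : ℝ, 0 ≤ Gh ν k) →
        ∀ a : ℝ, 0 < a → ∀ ε : ℝ, 0 < ε → ∃ ν₀ : ℝ, 0 < ν₀ ∧ ∀ ν : ℝ, 0 < ν → ν ≤ ν₀ →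
          ∀ k : ℝ, |k| ≤ a * Real.sqrt ν → Gh ν k ≤ Gh ν 0 + ε) := by
  classical
  intro H
  -- the witness
  set tri : ℕ → ℤ → ℝ := fun n x =>
    (((Finset.range n ×ˢ Finset.range n).filter
      (fun ab : ℕ × ℕ => x = (ab.1 : ℤ) - (ab.2 : ℤ))).card : ℝ) / (n : ℝ) ^ 2 with htri_def
  have htri : ∀ (n : ℕ) (x : ℤ), tri n x =
      (((Finset.range n ×ˢ Finset.range n).filter
        (fun ab : ℕ × ℕ => x = (ab.1 : ℤ) - (ab.2 : ℤ))).card : ℝ) / (n : ℝ) ^ 2 := fun n x => rfl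
  set prof : ℕ → ℤ → ℝ := fun n x => 5 / 8 * tri n x
    + 1 / 4 * (tri n (x - 2 * (n : ℤ)) + tri n (x + 2 * (n : ℤ)))
    - 1 / 16 * (tri n (x - 4 * (n : ℤ)) + tri n (x + 4 * (n : ℤ))) with hprof_def
  have hprof : ∀ (n : ℕ) (x : ℤ), prof n x = 5 / 8 * tri n x
      + 1 / 4 * (tri n (x - 2 * (n : ℤ)) + tri n (x + 2 * (n : ℤ)))
      - 1 / 16 * (tri n (x - 4 * (n : ℤ)) + tri n (x + 4 * (n : ℤ))) := fun n x => rfl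
  set N : ℝ → ℕ := fun ν => ⌈(Real.sqrt ν)⁻¹⌉₊ with hN_def
  set S0 : ℤ → ℝ := fun x => if x = 0 then 1 else 0 with hS0_def
  set Sb : ℝ → ℤ → ℝ := fun ν x => prof (N ν) x with hSb_def
  set fh : ℝ → ℝ → ℝ := fun ν k => ∑' x : ℤ, Real.cos (k * (x : ℝ)) * Sb ν x with hfh_def
  set χk : ℝ → ℝ := fun k => ∑' x : ℤ, Real.cos (k * (x : ℝ)) * S0 x with hχk_def
  set Gh : ℝ → ℝ → ℝ := fun ν k => if Real.cos k = 1
    then ν / 2 * ((∑' x : ℤ, (x : ℝ) ^ 2 * Sb ν x) - ∑' x : ℤ, (x : ℝ) ^ 2 * S0 x)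
    else ν * (χk k - fh ν k) / (2 - 2 * Real.cos k) with hGh_def
  -- elementary facts about the witness
  have hN1 : ∀ ν : ℝ, 0 < ν → 1 ≤ N ν := fun ν hν =>
    Nat.ceil_pos.mpr (inv_pos.mpr (Real.sqrt_pos.mpr hν))
  have hχk : ∀ k : ℝ, χk k = 1 := by
    intro k
    simp only [hχk_def, hS0_def]
    rw [tsum_eq_single 0]
    · simp
    · intro x hx; simp [hx]
  have hS0sq : ∑' x : ℤ, (x : ℝ) ^ 2 * S0 x = 0 := by
    simp only [hS0_def]
    rw [tsum_eq_single 0]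
    · simp
    · intro x hx; simp [hx]
  have hSb1 : ∀ ν : ℝ, 0 < ν → ∑' x : ℤ, Sb ν x = 1 := fun ν hν =>
    tsum_prof htri hprof (N ν) (hN1 ν hν)
  have hfh0 : ∀ ν : ℝ, 0 < ν → ∀ k : ℝ, 0 ≤ fh ν k := fun ν _ k =>
    tsum_cos_mul_prof_nonneg htri hprof (N ν) k
  have hfh1 : ∀ ν : ℝ, 0 < ν → ∀ k : ℝ, fh ν k ≤ 1 := fun ν hν k =>
    tsum_cos_mul_prof_le_one htri hprof (N ν) (hN1 ν hν) k
  have hfh_one : ∀ ν : ℝ, 0 < ν → ∀ k : ℝ, Real.cos k = 1 → fh ν k = 1 := by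
    intro ν hν k hk
    obtain ⟨m, hm⟩ := (Real.cos_eq_one_iff k).mp hk
    have hc : ∀ x : ℤ, Real.cos (k * (x : ℝ)) = 1 := by
      intro x
      rw [← hm, show (m : ℝ) * (2 * Real.pi) * x = ((m * x : ℤ) : ℝ) * (2 * Real.pi) by
        push_cast; ring]
      exact Real.cos_int_mul_two_pi _
    simp only [hfh_def, hc, one_mul]
    exact hSb1 ν hν
  have hM : ∀ ν : ℝ, 0 < ν → ∑' x : ℤ, (x : ℝ) ^ 2 * Sb ν x = (((N ν : ℕ) : ℝ) ^ 2 - 1) / 6 :=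
    fun ν hν => tsum_sq_mul_prof htri hprof (N ν) (hN1 ν hν)
  have hGh0 : ∀ ν : ℝ, Gh ν 0 =
      ν / 2 * ((∑' x : ℤ, (x : ℝ) ^ 2 * Sb ν x) - ∑' x : ℤ, (x : ℝ) ^ 2 * S0 x) := by
    intro ν; simp only [hGh_def, Real.cos_zero, if_true]
  have hSb0 : ∀ ν : ℝ, 0 < ν → Sb ν 0 = 5 / (8 * (N ν : ℝ)) := fun ν hν =>
    prof_zero htri hprof (N ν) (hN1 ν hν)
  -- the hypotheses of the shell
  have h4 : ∀ ν : ℝ, 0 < ν → Summable (fun x : ℤ => (1 + (x : ℝ) ^ 2) * |Sb ν x|) :=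
    fun ν _ => summable_weight_prof htri hprof (N ν)
  have h5 : Summable (fun x : ℤ => (1 + (x : ℝ) ^ 2) * |S0 x|) := by
    refine summable_of_ne_finset_zero (s := {0}) (fun x hx => ?_)
    rw [Finset.mem_singleton] at hx
    simp [hS0_def, hx]
  have h6 : 0 < χk 0 := by rw [hχk]; norm_num
  have h7 : ∀ ν : ℝ, 0 < ν → ∑' x : ℤ, Sb ν x = χk 0 := fun ν hν => by
    rw [hχk]; exact hSb1 ν hν
  have h9 : ∀ ν : ℝ, 0 < ν → ∫ k in (-Real.pi)..Real.pi, fh ν k = 2 * Real.pi * Sb ν 0 :=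
    fun ν hν => parseval_prof htri hprof (N ν) (hN1 ν hν)
  have h11 : ∀ ν : ℝ, 0 < ν → ∀ k : ℝ, χk k - fh ν k = (2 - 2 * Real.cos k) * Gh ν k / ν := by
    intro ν hν k
    by_cases hc : Real.cos k = 1
    · rw [hχk, hfh_one ν hν k hc, hc]; ring
    · have hGhk : Gh ν k = ν * (χk k - fh ν k) / (2 - 2 * Real.cos k) := by
        simp only [hGh_def, if_neg hc]
      have hden : 2 - 2 * Real.cos k ≠ 0 := by
        intro h; apply hc; linarith
      rw [hGhk]; field_simp
  have h12 : ∀ ν : ℝ, 0 < ν →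
      Gh ν 0 = ν / 2 * ((∑' x : ℤ, (x : ℝ) ^ 2 * Sb ν x) - ∑' x : ℤ, (x : ℝ) ^ 2 * S0 x) :=
    fun ν _ => hGh0 ν
  have hsymSb : ∀ ν : ℝ, 0 < ν → ∀ x : ℤ, Sb ν (-x) = Sb ν x := fun ν _ x =>
    prof_neg htri hprof (N ν) x
  have hsymS0 : ∀ x : ℤ, S0 (-x) = S0 x := by intro x; simp [hS0_def]
  have hΨ : ∀ ν : ℝ, 0 < ν → 0 ≤ Sb ν 0 := fun ν hν => by rw [hSb0 ν hν]; positivity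
  have hK1 : ∃ C ν₀ : ℝ, 0 < ν₀ ∧ ∀ ν : ℝ, 0 < ν → ν ≤ ν₀ → Sb ν 0 ≤ C * Real.sqrt ν := by
    refine ⟨5 / 8, 1, one_pos, fun ν hν _ => ?_⟩
    rw [hSb0 ν hν]
    have hs : 0 < Real.sqrt ν := Real.sqrt_pos.mpr hν
    have hNr : (Real.sqrt ν)⁻¹ ≤ (N ν : ℝ) := Nat.le_ceil _
    have hNpos : (0 : ℝ) < N ν := by exact_mod_cast hN1 ν hν
    have h1 : 1 ≤ Real.sqrt ν * (N ν : ℝ) := by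
      calc (1 : ℝ) = Real.sqrt ν * (Real.sqrt ν)⁻¹ := (mul_inv_cancel₀ hs.ne').symm
        _ ≤ Real.sqrt ν * (N ν : ℝ) := mul_le_mul_of_nonneg_left hNr hs.le
    rw [div_le_iff₀ (by positivity)]
    nlinarith
  have hSC : ∃ B ν₁ : ℝ, 0 < ν₁ ∧ ∀ ν : ℝ, 0 < ν → ν ≤ ν₁ →
      ∑' x : ℤ, (x : ℝ) ^ 2 * Sb ν x ≤ B / ν := by
    refine ⟨1, 1, one_pos, fun ν hν hν1 => ?_⟩
    rw [hM ν hν]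
    have h1 := mul_ceil_sq_le hν
    have hs1 : Real.sqrt ν ≤ 1 := Real.sqrt_le_one.mpr hν1
    have hs0 : 0 ≤ Real.sqrt ν := Real.sqrt_nonneg ν
    rw [div_le_div_iff₀ (by norm_num) hν]
    nlinarith
  have hreg : ∃ κ₀ : ℝ, 0 < κ₀ ∧
      Filter.Tendsto (fun ν : ℝ => Gh ν 0) (nhdsWithin (0:ℝ) (Set.Ioi 0)) (nhds κ₀) := by
    refine ⟨1 / 12, by norm_num, tendsto_ceil_model.congr' ?_⟩
    filter_upwards [self_mem_nhdsWithin] with ν hν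
    rw [hGh0 ν, hM ν (Set.mem_Ioi.mp hν), hS0sq]
  have hpos : ∀ ν : ℝ, 0 < ν → ∀ k : ℝ, 0 ≤ Gh ν k := by
    intro ν hν k
    by_cases hc : Real.cos k = 1
    · have : Gh ν k = ν / 2 * ((∑' x : ℤ, (x : ℝ) ^ 2 * Sb ν x) - ∑' x : ℤ, (x : ℝ) ^ 2 * S0 x) := by
        simp only [hGh_def, if_pos hc]
      rw [this, hM ν hν, hS0sq]
      have : (1 : ℝ) ≤ (N ν : ℝ) := by exact_mod_cast hN1 ν hν
      have h2 : 0 ≤ ((N ν : ℕ) : ℝ) ^ 2 - 1 := by nlinarith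
      have h3 : 0 ≤ ν / 2 * ((((N ν : ℕ) : ℝ) ^ 2 - 1) / 6 - 0) :=
        mul_nonneg (by positivity) (by linarith)
      exact h3
    · have hGhk : Gh ν k = ν * (χk k - fh ν k) / (2 - 2 * Real.cos k) := by
        simp only [hGh_def, if_neg hc]
      rw [hGhk, hχk]
      refine div_nonneg (mul_nonneg hν.le (by linarith [hfh1 ν hν k])) ?_
      linarith [Real.cos_le_one k]
  -- apply the shell to the witness with `a = 2`, `ε = 1/4`
  obtain ⟨ν₀, hν₀, Hc⟩ := H S0 Sb Gh fh χk rfl rfl h4 h5 h6 h7 hfh0 h9 h11 h12 hsymSb hsymS0 hΨ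
    hK1 hSC hreg hpos 2 two_pos (1 / 4) (by norm_num)
  -- the failing scale `ν = 1/m²`, wavenumber `k = π/(2m)`
  obtain ⟨m, hm⟩ := exists_nat_gt ((Real.sqrt ν₀)⁻¹)
  have hr : 0 < (Real.sqrt ν₀)⁻¹ := inv_pos.mpr (Real.sqrt_pos.mpr hν₀)
  have hm0 : (0 : ℝ) < m := hr.trans hm
  have hm0' : (m : ℝ) ≠ 0 := hm0.ne'
  set ν : ℝ := ((m : ℝ) ^ 2)⁻¹ with hν_def
  have hν : 0 < ν := by positivity
  have hνle : ν ≤ ν₀ := by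
    have h1 : ν₀⁻¹ < (m : ℝ) ^ 2 := by
      calc ν₀⁻¹ = ((Real.sqrt ν₀)⁻¹) ^ 2 := by rw [inv_pow, Real.sq_sqrt hν₀.le]
        _ < (m : ℝ) ^ 2 := pow_lt_pow_left₀ hm hr.le two_ne_zero
    have h2 := (inv_lt_inv₀ (by positivity) (inv_pos.mpr hν₀)).mpr h1
    rw [inv_inv] at h2
    exact h2.le
  have hsqrt : Real.sqrt ν = ((m : ℝ))⁻¹ := by
    rw [hν_def, Real.sqrt_inv, Real.sqrt_sq hm0.le]
  have hNm : N ν = m := by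
    simp only [hN_def]
    rw [hsqrt, inv_inv, Nat.ceil_natCast]
  set k : ℝ := Real.pi / (2 * m) with hk_def
  have hkpos : 0 < k := by positivity
  have hk2π : k < 2 * Real.pi := by
    rw [hk_def, div_lt_iff₀ (by positivity)]
    have h1 : (1 : ℝ) ≤ m := by exact_mod_cast Nat.one_le_iff_ne_zero.mpr (by rintro rfl; simp at hm0)
    nlinarith [Real.pi_pos]
  have hkwin : |k| ≤ 2 * Real.sqrt ν := by
    rw [abs_of_pos hkpos, hsqrt, hk_def, div_le_iff₀ (by positivity)]
    calc Real.pi ≤ 4 := Real.pi_le_four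
      _ = 2 * ((m : ℝ))⁻¹ * (2 * m) := by field_simp; norm_num
  have HH := Hc ν hν hνle k hkwin
  -- evaluate both sides
  have hcosk : Real.cos k ≠ 1 := by
    rw [Ne, Real.cos_eq_one_iff_of_lt_of_lt (by linarith [Real.pi_pos]) hk2π]
    exact hkpos.ne'
  have hfhk : fh ν k = 0 := by
    show (∑' x : ℤ, Real.cos (k * (x : ℝ)) * prof (N ν) x) = 0
    rw [hNm, tsum_cos_mul_prof htri hprof m k]
    have e1 : k * (2 * m) = Real.pi := by rw [hk_def]; field_simp
    have e2 : k * (4 * m) = 2 * Real.pi := by rw [hk_def]; field_simp; ring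
    rw [e1, e2, Real.cos_pi, Real.cos_two_pi]
    ring
  have hGhk : Gh ν k = ν / (2 - 2 * Real.cos k) := by
    have : Gh ν k = ν * (χk k - fh ν k) / (2 - 2 * Real.cos k) := by
      simp only [hGh_def, if_neg hcosk]
    rw [this, hχk, hfhk]; ring
  have hden : 0 < 2 - 2 * Real.cos k := by
    have : Real.cos k < 1 := lt_of_le_of_ne (Real.cos_le_one k) hcosk
    linarith
  have hden2 : 2 - 2 * Real.cos k ≤ k ^ 2 := by
    have := Real.one_sub_sq_div_two_le_cos (x := k)
    linarith
  have hlow : 2 / 5 < Gh ν k := by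
    rw [hGhk]
    have h1 : ν / k ^ 2 ≤ ν / (2 - 2 * Real.cos k) := div_le_div_of_nonneg_left hν.le hden hden2
    have h2 : ν / k ^ 2 = 4 / Real.pi ^ 2 := by
      rw [hν_def, hk_def]; field_simp; ring
    have h3 : (2 : ℝ) / 5 < 4 / Real.pi ^ 2 := by
      rw [div_lt_div_iff₀ (by norm_num) (by positivity)]
      nlinarith [Real.pi_lt_d2, Real.pi_pos]
    linarith
  have hup : Gh ν 0 ≤ 1 / 12 := by
    rw [hGh0 ν, hM ν hν, hS0sq, hNm]
    have e : ν * (m : ℝ) ^ 2 = 1 := by rw [hν_def]; field_simp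
    nlinarith
  linarith

end Summit.AtomisticToContinuum.FouriersLaw.Theorems.CornerNoDip.Negative.ColdHalo

end
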